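import Summits.QuantumAdvantage.AdviceFreeQNC0.BlockCombGate37
import HarnessLib

/-!
# Cell qa-qnc0 — P-37c (c4)+(c4⁺): «(G_r) FOR ANY NUMBER `r` OF COMMON GATES» — `gatesHardConst`, `gatesHardLog`
# (planner qa-qnc0-p1 gen 37, source HOME/qa-qnc0-p1/exp37/BlockComb37.lean §§11–13; in every window of `3^r + 1` letters two
# coefficient COLUMNS `Fin r → ZMod 3` are equal (pigeonhole `window_pair`); the block between them (length `≤ 3^r`) is blind for
# all `r` gates when its boundary letters differ (`gateSum_cplR`); a broken admissibility is repaired by ONE in-block bit flip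
# (`adm_fix`); period `3^r + 3`, `gateCDR ℓ : CombData n (n/(3^r+3) − 1)`; `gatesHardLog` is uniform in `r` under
# `3^r·(log₂ n)^{2C+2} ≤ n`; `gatesHardConst_of_log : GatesHardLog → GatesHardConst`)
-/

noncomputable section

open Classical

namespace Summit.QuantumAdvantage.AdviceFreeQNC0

open Finset
open Literature.Computability.MetaComplexity Literature.Computability.MetaComplexity.Smolensky
open F4 AffBells22 Subcube

namespace BlockFibre37

variable {n m : ℕ}
variable {K : ℕ}

/-! ### 11. (c4) ANY CONSTANT NUMBER OF GATES: two equal coefficient COLUMNS in every window of `3^r + 1` positions -/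

/-- a broken admissibility is repaired by flipping any bit inside the block (`bwt ≡ 0 ⇒ bwt ± 1 ≢ 0`). -/
theorem adm_fix (B : BlockFam n m) (u : Fin n → Bool) {k : Fin m} {i₀ : Fin n} (h : InBlock B k i₀)
    (hna : ¬ Admissible B u k) : Admissible B (flipN i₀.val u) k := by
  have key := bwt_flipN_mem B u h
  unfold Admissible at *
  cases hu : u i₀ <;> simp [hu] at key <;> omega

/-- the head computation for equal coefficients. -/
theorem head_eq : ∀ (c : ZMod 3) (xa xb : Bool), xa ≠ xb →
    (if (!xa) = true then c else 0) + (if (!xb) = true then c else 0)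
      = (if xa = true then c else 0) + (if xb = true then c else 0) := by
  decide

section Gates

variable {r : ℕ}

/-- the coefficient COLUMN at natural position `q`. -/
def colN (ℓ : Fin r → Fin (n + 1) → ZMod 3) (q : ℕ) : Fin r → ZMod 3 := fun i => ellN (ℓ i) q

/-- pigeonhole: in every window of `3^r + 1` positions two columns are equal. -/
theorem window_pair (ℓ : Fin r → Fin (n + 1) → ZMod 3) (p : ℕ) :
    ∃ ab : ℕ × ℕ, p ≤ ab.1 ∧ ab.1 < ab.2 ∧ ab.2 ≤ p + 3 ^ r ∧ colN ℓ ab.1 = colN ℓ ab.2 := by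
  have hcard : Fintype.card (Fin r → ZMod 3) < Fintype.card (Fin (3 ^ r + 1)) := by
    rw [Fintype.card_fun, ZMod.card, Fintype.card_fin, Fintype.card_fin]; omega
  obtain ⟨i, j, hne, heq⟩ :=
    Fintype.exists_ne_map_eq_of_card_lt (fun i : Fin (3 ^ r + 1) => colN ℓ (p + i.val)) hcard
  have hij : i.val ≠ j.val := fun h => hne (Fin.ext h)
  rcases Nat.lt_or_gt_of_ne hij with h | h
  · exact ⟨(p + i.val, p + j.val), by simp only; omega, by simp only; omega, by simp only; omega, heq⟩
  · exact ⟨(p + j.val, p + i.val), by simp only; omega, by simp only; omega, by simp only; omega, heq.symm⟩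

/-- the chosen pair of the window starting at `p`. -/
def pairR (ℓ : Fin r → Fin (n + 1) → ZMod 3) (p : ℕ) : ℕ × ℕ := Classical.choose (window_pair ℓ p)

/-- The chosen pair of positions in `[p, p + 3^r]` is ordered and carries equal coefficient columns. -/
theorem pairR_spec (ℓ : Fin r → Fin (n + 1) → ZMod 3) (p : ℕ) :
    p ≤ (pairR ℓ p).1 ∧ (pairR ℓ p).1 < (pairR ℓ p).2 ∧ (pairR ℓ p).2 ≤ p + 3 ^ r ∧ colN ℓ (pairR ℓ p).1 = colN ℓ (pairR ℓ p).2 :=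
  Classical.choose_spec (window_pair ℓ p)

/-- period of the comb: a window of `3^r + 1` letters plus margins. -/
def base (r k : ℕ) : ℕ := (3 ^ r + 3) * k

/-- Consecutive comb bases are `3^r + 3` apart. -/
theorem base_mono {k k' : ℕ} (h : k < k') : base r k + 3 ^ r + 3 ≤ base r k' := by
  unfold base
  have h1 := Nat.mul_le_mul_left (3 ^ r + 3) (show k + 1 ≤ k' by omega)
  have e : (3 ^ r + 3) * (k + 1) = (3 ^ r + 3) * k + (3 ^ r + 3) := by ring
  omega

/-- number of blocks of the `r`-gate comb. -/
def KR (r n : ℕ) : ℕ := n / (3 ^ r + 3) - 1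

/-- Every comb index has its window inside the ring: `base + 2·3^r + 6 ≤ n`. -/
theorem base_bound (k : Fin (KR r n)) : base r k.val + 2 * 3 ^ r + 6 ≤ n := by
  have h1 : k.val + 2 ≤ n / (3 ^ r + 3) := by have := k.2; unfold KR at this; omega
  have h2 : (k.val + 2) * (3 ^ r + 3) ≤ n := (Nat.le_div_iff_mul_le (by positivity)).1 h1
  unfold base
  have e : (k.val + 2) * (3 ^ r + 3) = (3 ^ r + 3) * k.val + 2 * 3 ^ r + 6 := by ring
  omega

/-- start / length of block `k`. -/
def stR (ℓ : Fin r → Fin (n + 1) → ZMod 3) (k : Fin (KR r n)) : ℕ := (pairR ℓ (base r k.val + 2)).1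
/-- length of block `k` (`1 ≤ lenR ≤ 3^r`). -/
def lenR (ℓ : Fin r → Fin (n + 1) → ZMod 3) (k : Fin (KR r n)) : ℕ :=
  (pairR ℓ (base r k.val + 2)).2 - (pairR ℓ (base r k.val + 2)).1

/-- Block `k` sits inside its window, has length in `[1, 3^r]`, and its endpoints carry equal coefficient columns. -/
theorem stR_spec (ℓ : Fin r → Fin (n + 1) → ZMod 3) (k : Fin (KR r n)) :
    base r k.val + 2 ≤ stR ℓ k ∧ 1 ≤ lenR ℓ k ∧ stR ℓ k + lenR ℓ k ≤ base r k.val + 2 + 3 ^ r ∧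
      base r k.val + 2 * 3 ^ r + 6 ≤ n ∧ colN ℓ (stR ℓ k) = colN ℓ (stR ℓ k + lenR ℓ k) := by
  obtain ⟨h1, h2, h3, h4⟩ := pairR_spec ℓ (base r k.val + 2)
  have e : stR ℓ k + lenR ℓ k = (pairR ℓ (base r k.val + 2)).2 := by unfold stR lenR; omega
  refine ⟨h1, by unfold lenR; omega, by rw [e]; exact h3, base_bound k, ?_⟩
  rw [e]; exact h4

/-- boundary letters of block `k`. -/
def aFR (ℓ : Fin r → Fin (n + 1) → ZMod 3) (k : Fin (KR r n)) : Fin (n + 1) :=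
  ⟨stR ℓ k, by obtain ⟨_, _, h3, h4, _⟩ := stR_spec ℓ k; omega⟩
/-- the right endpoint `stR + lenR` of block `k` as an index of `Fin (n+1)`. -/
def bFR (ℓ : Fin r → Fin (n + 1) → ZMod 3) (k : Fin (KR r n)) : Fin (n + 1) :=
  ⟨stR ℓ k + lenR ℓ k, by obtain ⟨_, _, h3, h4, _⟩ := stR_spec ℓ k; omega⟩

/-- Value of the left endpoint index. -/
theorem aFR_val (ℓ : Fin r → Fin (n + 1) → ZMod 3) (k : Fin (KR r n)) : (aFR ℓ k).val = stR ℓ k := rfl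
/-- Value of the right endpoint index. -/
theorem bFR_val (ℓ : Fin r → Fin (n + 1) → ZMod 3) (k : Fin (KR r n)) : (bFR ℓ k).val = stR ℓ k + lenR ℓ k := rfl

/-- the `i`-th gate has equal coefficients at the two boundary letters. -/
theorem coeff_eq (ℓ : Fin r → Fin (n + 1) → ZMod 3) (k : Fin (KR r n)) (i : Fin r) : ℓ i (aFR ℓ k) = ℓ i (bFR ℓ k) := by
  have h := congrFun (stR_spec ℓ k).2.2.2.2 i
  unfold colN ellN at h
  rw [dif_pos (show stR ℓ k < n + 1 from (aFR ℓ k).2), dif_pos (show stR ℓ k + lenR ℓ k < n + 1 from (bFR ℓ k).2)] at h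
  exact h

/-- the block family of the `r` gates. -/
def gateFamR (ℓ : Fin r → Fin (n + 1) → ZMod 3) : BlockFam n (KR r n) where
  st k := stR ℓ k
  len k := lenR ℓ k
  len_pos k := (stR_spec ℓ k).2.1
  one_le k := by have := (stR_spec ℓ k).1; omega
  le_n k := by obtain ⟨_, _, h3, h4, _⟩ := stR_spec ℓ k; omega
  sep k k' h := by
    obtain ⟨_, _, h3, _, _⟩ := stR_spec ℓ k
    have h2 := (stR_spec ℓ k').1
    have hb := base_mono (r := r) (show k.val < k'.val from h)
    omega

/-- Length of block `k` of the `r`-gate family. -/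
theorem gateFamR_len (ℓ : Fin r → Fin (n + 1) → ZMod 3) (k : Fin (KR r n)) : (gateFamR ℓ).len k = lenR ℓ k := rfl
/-- Membership in block `k` of the `r`-gate family. -/
theorem inBlock_gateFamR (ℓ : Fin r → Fin (n + 1) → ZMod 3) (k : Fin (KR r n)) (i : Fin n) :
    InBlock (gateFamR ℓ) k i ↔ stR ℓ k ≤ i.val ∧ i.val < stR ℓ k + lenR ℓ k := Iff.rfl

/-- relation of block `k`: the boundary letters DIFFER (equal columns). -/
def RelR (ℓ : Fin r → Fin (n + 1) → ZMod 3) (k : Fin (KR r n)) (u : Fin n → Bool) : Prop :=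
  xOfU u (aFR ℓ k) ≠ xOfU u (bFR ℓ k)

/-- goodness of block `k`. -/
def GoodR (ℓ : Fin r → Fin (n + 1) → ZMod 3) (k : Fin (KR r n)) (u : Fin n → Bool) : Prop :=
  RelR ℓ k u ∧ Admissible (gateFamR ℓ) u k

/-- **blindness of every gate.** -/
theorem gateSum_cplR (ℓ : Fin r → Fin (n + 1) → ZMod 3) (k : Fin (KR r n)) (u : Fin n → Bool) (hg : GoodR ℓ k u)
    (i : Fin r) : gateSum (ℓ i) (cpl (gateFamR ℓ) k u) = gateSum (ℓ i) u := by
  obtain ⟨hs1, hl1, hs2, hn, -⟩ := stR_spec ℓ k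
  rw [cpl_eq_blockCompl]
  show gateSum (ℓ i) (Comb37.blockCompl u (stR ℓ k) (stR ℓ k + lenR ℓ k)) = gateSum (ℓ i) u
  have hab : stR ℓ k < stR ℓ k + lenR ℓ k := by omega
  have hbn : stR ℓ k + lenR ℓ k ≤ n := by omega
  have hxa : xOfU (Comb37.blockCompl u (stR ℓ k) (stR ℓ k + lenR ℓ k)) (aFR ℓ k) = !xOfU u (aFR ℓ k) :=
    Comb37.xOfU_blockCompl_left u hab hbn (aFR_val ℓ k)
  have hxb : xOfU (Comb37.blockCompl u (stR ℓ k) (stR ℓ k + lenR ℓ k)) (bFR ℓ k) = !xOfU u (bFR ℓ k) :=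
    Comb37.xOfU_blockCompl_right u hab hbn (bFR_val ℓ k)
  have hxo : ∀ j : Fin (n + 1), j ≠ aFR ℓ k → j ≠ bFR ℓ k →
      xOfU (Comb37.blockCompl u (stR ℓ k) (stR ℓ k + lenR ℓ k)) j = xOfU u j := by
    intro j h1 h2
    refine Comb37.xOfU_blockCompl_of_ne u hbn ?_ ?_
    · intro h; exact h1 (Fin.ext (by rw [aFR_val]; exact h))
    · intro h; exact h2 (Fin.ext (by rw [bFR_val]; exact h))
  have hne : aFR ℓ k ≠ bFR ℓ k := by
    intro h; have := congrArg Fin.val h; rw [aFR_val, bFR_val] at this; omega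
  unfold gateSum
  rw [sum_pair_rest hne, sum_pair_rest hne]
  have hrest : ∑ j ∈ (univ.erase (aFR ℓ k)).erase (bFR ℓ k),
      (if xOfU (Comb37.blockCompl u (stR ℓ k) (stR ℓ k + lenR ℓ k)) j = true then ℓ i j else 0)
      = ∑ j ∈ (univ.erase (aFR ℓ k)).erase (bFR ℓ k), (if xOfU u j = true then ℓ i j else 0) := by
    refine sum_congr rfl fun j hj => ?_
    have h2 : j ≠ bFR ℓ k := (mem_erase.1 hj).1
    have h1 : j ≠ aFR ℓ k := (mem_erase.1 (mem_erase.1 hj).2).1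
    rw [hxo j h1 h2]
  have hh := head_eq (ℓ i (aFR ℓ k)) (xOfU u (aFR ℓ k)) (xOfU u (bFR ℓ k)) hg.1
  rw [hrest, hxa, hxb, ← coeff_eq ℓ k i, hh]

/-- The relation predicate `RelR` is invariant under the own-block complement. -/
theorem relR_cpl (ℓ : Fin r → Fin (n + 1) → ZMod 3) (k : Fin (KR r n)) (u : Fin n → Bool) :
    RelR ℓ k (cpl (gateFamR ℓ) k u) ↔ RelR ℓ k u := by
  obtain ⟨hs1, hl1, hs2, hn, -⟩ := stR_spec ℓ k
  rw [cpl_eq_blockCompl]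
  show RelR ℓ k (Comb37.blockCompl u (stR ℓ k) (stR ℓ k + lenR ℓ k)) ↔ RelR ℓ k u
  have hab : stR ℓ k < stR ℓ k + lenR ℓ k := by omega
  have hbn : stR ℓ k + lenR ℓ k ≤ n := by omega
  unfold RelR
  rw [Comb37.xOfU_blockCompl_left u hab hbn (aFR_val ℓ k), Comb37.xOfU_blockCompl_right u hab hbn (bFR_val ℓ k)]
  cases xOfU u (aFR ℓ k) <;> cases xOfU u (bFR ℓ k) <;> simp

/-- Goodness `GoodR` is invariant under the own-block complement. -/
theorem goodR_cpl (ℓ : Fin r → Fin (n + 1) → ZMod 3) (k : Fin (KR r n)) (u : Fin n → Bool) (hg : GoodR ℓ k u) :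
    GoodR ℓ k (cpl (gateFamR ℓ) k u) := by
  refine ⟨(relR_cpl ℓ k u).2 hg.1, ?_⟩
  have h := bwt_cpl (gateFamR ℓ) k u
  have h2 := hg.2
  unfold Admissible at h2 ⊢
  omega

/-- Goodness of block `k` depends only on the input bits of its neighbourhood `[base+1, base+3^r+2]`. -/
theorem goodR_local (ℓ : Fin r → Fin (n + 1) → ZMod 3) (k : Fin (KR r n)) (u u' : Fin n → Bool)
    (h : ∀ i : Fin n, base r k.val + 1 ≤ i.val → i.val ≤ base r k.val + 3 ^ r + 2 → u i = u' i) (hg : GoodR ℓ k u) :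
    GoodR ℓ k u' := by
  obtain ⟨hs1, hl1, hs2, hn, -⟩ := stR_spec ℓ k
  have hU : ∀ q, base r k.val + 1 ≤ q → q ≤ base r k.val + 3 ^ r + 2 → uExt u q = uExt u' q := by
    intro q h1 h2
    exact uExt_congr (by omega) (h _ h1 h2)
  have ha : xOfU u (aFR ℓ k) = xOfU u' (aFR ℓ k) :=
    xOfU_congr (aFR ℓ k) (hU _ (by rw [aFR_val]; omega) (by rw [aFR_val]; omega))
      (hU _ (by rw [aFR_val]; omega) (by rw [aFR_val]; omega))
  have hb : xOfU u (bFR ℓ k) = xOfU u' (bFR ℓ k) :=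
    xOfU_congr (bFR ℓ k) (hU _ (by rw [bFR_val]; omega) (by rw [bFR_val]; omega))
      (hU _ (by rw [bFR_val]; omega) (by rw [bFR_val]; omega))
  have hw : bwt (gateFamR ℓ) u k = bwt (gateFamR ℓ) u' k :=
    bwt_congr (gateFamR ℓ) k fun i hi => by
      rw [inBlock_gateFamR] at hi
      exact h i (by omega) (by omega)
  refine ⟨?_, ?_⟩
  · have h1 := hg.1; unfold RelR at h1 ⊢; rw [← ha, ← hb]; exact h1
  · have h2 := hg.2; unfold Admissible at h2 ⊢; rw [← hw]; exact h2

/-- Flipping the bit at the right endpoint `β` toggles `RelR`. -/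
theorem relR_flipN_beta (ℓ : Fin r → Fin (n + 1) → ZMod 3) (k : Fin (KR r n)) (u : Fin n → Bool) :
    RelR ℓ k (flipN (stR ℓ k + lenR ℓ k) u) ↔ ¬ RelR ℓ k u := by
  obtain ⟨hs1, hl1, hs2, hn, -⟩ := stR_spec ℓ k
  unfold RelR
  rw [xOfU_flipN_of_ne _ u (by rw [aFR_val]; omega) (by rw [aFR_val]; omega),
    xOfU_flipN_self _ u (by omega) (bFR_val ℓ k)]
  cases xOfU u (aFR ℓ k) <;> cases xOfU u (bFR ℓ k) <;> simp

/-- Flipping the bit at `β` preserves admissibility of block `k`. -/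
theorem admR_flipN_beta (ℓ : Fin r → Fin (n + 1) → ZMod 3) (k : Fin (KR r n)) (u : Fin n → Bool) :
    Admissible (gateFamR ℓ) (flipN (stR ℓ k + lenR ℓ k) u) k ↔ Admissible (gateFamR ℓ) u k := by
  unfold Admissible
  rw [bwt_congr (gateFamR ℓ) k (u := flipN (stR ℓ k + lenR ℓ k) u) (u' := u) fun i hi => by
    rw [inBlock_gateFamR] at hi
    exact flipN_apply_of_ne _ u (by omega)]

/-- **abundance** for the `r`-gate comb. -/
theorem goodR_abundant (ℓ : Fin r → Fin (n + 1) → ZMod 3) (k : Fin (KR r n)) (u : Fin n → Bool) :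
    ∃ s t : Bool, GoodR ℓ k (flipB t (stR ℓ k + lenR ℓ k) (flipB s (stR ℓ k + lenR ℓ k - 1) u)) := by
  obtain ⟨hs1, hl1, hs2, hn, -⟩ := stR_spec ℓ k
  have step1 : ∃ s : Bool, Admissible (gateFamR ℓ) (flipB s (stR ℓ k + lenR ℓ k - 1) u) k := by
    by_cases hadm : Admissible (gateFamR ℓ) u k
    · exact ⟨false, by rw [flipB_false]; exact hadm⟩
    · have hlt : stR ℓ k + lenR ℓ k - 1 < n := by omega
      have hin : InBlock (gateFamR ℓ) k ⟨stR ℓ k + lenR ℓ k - 1, hlt⟩ := by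
        rw [inBlock_gateFamR]
        show stR ℓ k ≤ stR ℓ k + lenR ℓ k - 1 ∧ stR ℓ k + lenR ℓ k - 1 < stR ℓ k + lenR ℓ k
        omega
      exact ⟨true, by rw [flipB_true]; exact adm_fix (gateFamR ℓ) u hin hadm⟩
  obtain ⟨s, hs⟩ := step1
  by_cases hrel : RelR ℓ k (flipB s (stR ℓ k + lenR ℓ k - 1) u)
  · exact ⟨s, false, by rw [flipB_false]; exact ⟨hrel, hs⟩⟩
  · refine ⟨s, true, ?_⟩
    rw [flipB_true]
    exact ⟨(relR_flipN_beta ℓ k _).2 hrel, (admR_flipN_beta ℓ k _).2 hs⟩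

/-- **the comb data of `r` gates.** -/
def gateCDR (ℓ : Fin r → Fin (n + 1) → ZMod 3) : CombData n (KR r n) where
  fam := gateFamR ℓ
  lo k := base r k.val + 1
  hi k := base r k.val + 3 ^ r + 2
  lo_le k := by have := (stR_spec ℓ k).1; show base r k.val + 1 + 1 ≤ stR ℓ k; omega
  le_hi k := by have := (stR_spec ℓ k).2.2.1; show stR ℓ k + lenR ℓ k ≤ base r k.val + 3 ^ r + 2; omega
  hi_lt k := by have := base_bound (r := r) k; omega
  disj k k' h := by have := base_mono (r := r) (show k.val < k'.val from h); omega
  Good k u := GoodR ℓ k u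
  good_local k u u' h hg := goodR_local ℓ k u u' h hg
  good_cpl k u hg := goodR_cpl ℓ k u hg
  good_adm k u hg := hg.2
  pc k := stR ℓ k + lenR ℓ k - 1
  pd k := stR ℓ k + lenR ℓ k
  pc_mem k := by obtain ⟨h1, h2, h3, _⟩ := stR_spec ℓ k; omega
  pd_mem k := by obtain ⟨h1, h2, h3, _⟩ := stR_spec ℓ k; omega
  abundant k u := goodR_abundant ℓ k u

end Gates

/-! ### 12. (c4) (G_r) FOR ANY CONSTANT NUMBER OF GATES -/

/-- **(G_r) for any constant number `r` of gates.** -/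
theorem gatesHardConst : GatesHardConst := by
  obtain ⟨θ, hθ, hmain⟩ := blockComb_le
  refine ⟨θ, hθ, fun r C => ?_⟩
  obtain ⟨A, n₀, hA⟩ := hmain C
  obtain ⟨n₁, hn₁⟩ := DWalk.const_mul_logPow_le' ((3 ^ r + 3) * (A + 2)) (2 * C + 1)
  refine ⟨max (max n₀ n₁) 2, fun n hn ℓ c T f G hloc => ?_⟩
  have hn0 : n₀ ≤ n := le_trans (le_trans (le_max_left _ _) (le_max_left _ _)) hn
  have hn1 : n₁ ≤ n := le_trans (le_trans (le_max_right _ _) (le_max_left _ _)) hn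
  have hn2 : 2 ≤ n := le_trans (le_max_right _ _) hn
  have hL1 : 1 ≤ Nat.log 2 n := Nat.le_log_of_pow_le (by norm_num) (by simpa using hn2)
  have hK : A * (Nat.log 2 n) ^ (2 * C + 1) ≤ KR r n := by
    have h := hn₁ n hn1
    have hL : 1 ≤ (Nat.log 2 n) ^ (2 * C + 1) := Nat.one_le_pow _ _ hL1
    unfold KR
    generalize (Nat.log 2 n) ^ (2 * C + 1) = P at h hL ⊢
    have h1 : A * P + 2 ≤ (A + 2) * P := by nlinarith
    have h2 : (A * P + 2) * (3 ^ r + 3) ≤ n := by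
      refine le_trans (Nat.mul_le_mul_right _ h1) ?_
      have e : (A + 2) * P * (3 ^ r + 3) = (3 ^ r + 3) * (A + 2) * P := by ring
      rw [e]; exact h
    have h3 : A * P + 2 ≤ n / (3 ^ r + 3) := (Nat.le_div_iff_mul_le (by positivity)).2 h2
    omega
  exact hA n hn0 (KR r n) (gateCDR ℓ) hK c T (fun u => f (fun i => gateSum (ℓ i) u)) G
    (fun u k hk => congrArg f (funext fun i => gateSum_cplR ℓ k u hk i)) hloc

/-! ### 13. (c4⁺) a GROWING number of common gates: `3^r · (log₂ n)^{2C+2} ≤ n` -/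

/-- **(G_log)** (target and theorem): the conclusion of `GatesHardConst` UNIFORMLY for every number `r` of common gates with
`3^r · (log₂ n)^{2C+2} ≤ n`, i.e. up to `log₃ n − (2C+2)·log₃ log₂ n` dense `MOD₃` gates feeding one arbitrary selector. -/
def GatesHardLog : Prop :=
  ∃ θ : ℝ, θ < 1 ∧ ∀ C : ℕ, ∃ n₀ : ℕ, ∀ n ≥ n₀, ∀ r : ℕ, 3 ^ r * (Nat.log 2 n) ^ (2 * C + 2) ≤ n →
    ∀ (ℓ : Fin r → Fin (n + 1) → ZMod 3) (c : ℕ) (T : Type)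
    (f : (Fin r → ZMod 3) → T) (G : T → Fin (n + 1) → (Fin n → Bool) → Bool),
    (∀ t, WindowLocal ((Nat.log 2 n) ^ C) (G t)) →
    ((univ.filter fun u : Fin n → Bool =>
        ringWinU c (fun g u => G (f (fun i => gateSum (ℓ i) u)) g u) u = true).card : ℝ) ≤ θ * (2 : ℝ) ^ n

/-- **(G_log)**: up to `r` common dense MOD₃ gates with `3^r (log₂ n)^{2C+2} ≤ n`, window-local branches, any selector: wins `≤ θ·2ⁿ`, `θ < 1` absolute. -/
theorem gatesHardLog : GatesHardLog := by
  obtain ⟨θ, hθ, hmain⟩ := blockComb_le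
  refine ⟨θ, hθ, fun C => ?_⟩
  obtain ⟨A, n₀, hA⟩ := hmain C
  refine ⟨max n₀ (2 ^ (4 * A + 8)), fun n hn r hr ℓ c T f G hloc => ?_⟩
  have hn0 : n₀ ≤ n := le_trans (le_max_left _ _) hn
  have hn1 : 2 ^ (4 * A + 8) ≤ n := le_trans (le_max_right _ _) hn
  have hL : 4 * A + 8 ≤ Nat.log 2 n := Nat.le_log_of_pow_le (by norm_num) hn1
  have hK : A * (Nat.log 2 n) ^ (2 * C + 1) ≤ KR r n := by
    unfold KR
    have e : (Nat.log 2 n) ^ (2 * C + 2) = (Nat.log 2 n) ^ (2 * C + 1) * Nat.log 2 n := pow_succ _ _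
    rw [e] at hr
    have hP : 1 ≤ (Nat.log 2 n) ^ (2 * C + 1) := Nat.one_le_pow _ _ (by omega)
    generalize (Nat.log 2 n) ^ (2 * C + 1) = P at hr hP ⊢
    generalize Nat.log 2 n = L at hr hL ⊢
    have ht : 1 ≤ 3 ^ r := Nat.one_le_pow _ _ (by norm_num)
    generalize 3 ^ r = t at hr ht ⊢
    have hAPt : A * P ≤ A * P * t := Nat.le_mul_of_pos_right _ ht
    have htP : t ≤ t * P := Nat.le_mul_of_pos_right _ hP
    have h1 : (A * P + 2) * (t + 3) ≤ (4 * A + 8) * (t * P) := by nlinarith [hAPt, htP, ht, hP]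
    have h2 : (A * P + 2) * (t + 3) ≤ n :=
      le_trans h1 (le_trans (Nat.mul_le_mul_right _ hL) (by nlinarith [hr]))
    have h3 : A * P + 2 ≤ n / (t + 3) := (Nat.le_div_iff_mul_le (by omega)).2 h2
    omega
  exact hA n hn0 (KR r n) (gateCDR ℓ) hK c T (fun u => f (fun i => gateSum (ℓ i) u)) G
    (fun u k hk => congrArg f (funext fun i => gateSum_cplR ℓ k u hk i)) hloc

/-- (G_log) contains (G_r) for every constant `r` (sanity / alternative proof of `gatesHardConst`). -/
theorem gatesHardConst_of_log (h : GatesHardLog) : GatesHardConst := by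
  obtain ⟨θ, hθ, hmain⟩ := h
  refine ⟨θ, hθ, fun r C => ?_⟩
  obtain ⟨n₀, hA⟩ := hmain C
  obtain ⟨n₁, hn₁⟩ := DWalk.const_mul_logPow_le' (3 ^ r) (2 * C + 2)
  exact ⟨max n₀ n₁, fun n hn ℓ c T f G hloc =>
    hA n (le_trans (le_max_left _ _) hn) r (hn₁ n (le_trans (le_max_right _ _) hn)) ℓ c T f G hloc⟩

end BlockFibre37

end Summit.QuantumAdvantage.AdviceFreeQNC0
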